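import Summits.FinalStateConjecture.FinalStateConjecture.Theorems.ChannelsResolveTameDevelopmentsR.Negative.ExactSchwarzschildExteriorOf
import HarnessLib

/-!
# Route PhotonSphereChannels · crux `ChannelsResolveTameDevelopmentsR` (K2R-T2, stmt-FinalStateConjecture-17430) —
# the SCHWARZSCHILD END, I: causal anatomy of the far cylinder of the horizon-penetrating
# Kerr–Schild patch (`I⁺(cyl) = everything`, `I⁻(cyl) = {r > 2M}`, d.o.c. `= {r > 2M}`,
# future event horizon `= {r = 2M} ≠ ∅`)

The hull interface of the crux (`Theorems/PhotonSphereChannelsTameHullDefs.lean`: `EndDatum.IsTameEnd`,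
`EndDatum.doc = I⁺(far) ∩ I⁻(far)`, `EndDatum.horizon = ∂I⁻(far) ∩ I⁺(far)`, `IsKerrDoc`) has so far ONE
certified inhabitant, the flat end (`…RFlatTameEnd.lean`), whose horizon is empty: the horizon clauses and the
Kerr branch of every stub of line `dark-future-exactness` are exercised only vacuously. This is file I of the
HORIZON-SIDE witness, the exact Schwarzschild end: on the ingoing Kerr–Schild patch
`Kerr.spacetime M 0 r₁ = ({r > r₁}, η + (2M/r) ℓ ⊗ ℓ, −g♯dt*)`, `0 < r₁ < 2M` (it contains the horizon `{r = 2M}`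
and a collar of the black hole), with asymptotic region the eternal far cylinder `cyl_R = {r > R}`, `R ≥ 2M`:

* `Schw.exists_far_mem_chronologicalFuture` / `Schw.exists_far_mem_chronologicalPast` — OUTGOING radial
  timelike segments from `{r > 2M}` reach `{r > R'}`, and every point of the patch (inside the black hole too)
  is the endpoint of an INGOING radial timelike segment issued from `{r > R'}`, for every `R'`;
* `Schw.chronologicalFuture_farCylinder_eq_univ`, `Schw.chronologicalPast_farCylinder_eq` —
  `I⁺(cyl_R) = {r > r₁}`, `I⁻(cyl_R) = {r > 2M}` (no escape: `SchwModelT2.chronologicalPast_subset_O`);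
* `Schw.docOfEnd_farCylinder_eq`, `Schw.futureEventHorizonOfEnd_farCylinder_eq` — the d.o.c. of the
  cylinder end is `{r > 2M}` and its future event horizon is EXACTLY the Schwarzschild horizon `{r = 2M}`.

Everything is proved; `[Kerr.Facts]` is the instance hypothesis of `Kerr.spacetime` (dischargeable by
`Kerr.isConnected_region_holds`, `Kerr.contMDiff_bilin_holds`, `Kerr.contMDiff_timeVector_holds`). No definitions.
References: B. O'Neill, *The geometry of Kerr black holes* (1995), §2.5 [ONeill1995]; B. O'Neill,
*Semi-Riemannian geometry* (1983), Ch. 14, pp. 402–403 [ONeill1983]; M. Dafermos, I. Rodnianski,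
arXiv:0811.0354, §5.1 [DafermosRodnianski2008]; R. M. Wald, *General Relativity* (1984), §12.1 [Wald1984].
-/

noncomputable section
set_option maxSynthPendingDepth 3 -- nested operator types `E4 →L E4 →L E4 →L ℝ` (as in the tree files)
set_option linter.dupNamespace false -- `Summit.FinalStateConjecture.FinalStateConjecture.…` is the tree's layout

open TopologicalSpace Manifold Filter Topology Set Function
open scoped ContDiff Topology ENNReal Manifold InnerProductSpace

namespace Summit.FinalStateConjecture.FinalStateConjecture.Theorems.TameHull.Schw

open Literature.Geometry.Lorentzian LorentzianMetric
open Summit.FinalStateConjecture.FinalStateConjecture.Theorems.SeamedChartsExhaust.Negative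
open Summit.FinalStateConjecture.FinalStateConjecture.Theorems.ChannelsResolveTameDevelopmentsR.Negative

variable {M r₁ : ℝ} {hM : 0 ≤ M}

/-! ### Radial vectors in the Schwarzschild Kerr–Schild chart -/
/-- The radial coordinate vector `(T, c x⃗)` at the point `x`. [folklore] -/
theorem spatial_radialVec (x : E4) (T c : ℝ) :
    E4.spatial (E4.ofTimeSpace T (c • E4.spatial x)) = c • E4.spatial x :=
  E4.spatial_ofTimeSpace _ _

/-- Along the line `x + σ (T, c x⃗)` the spatial part is `(1 + σ c) x⃗`. [folklore] -/
theorem spatial_add_smul_radialVec (x : E4) (T c σ : ℝ) :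
    E4.spatial (x + σ • E4.ofTimeSpace T (c • E4.spatial x)) = (1 + σ * c) • E4.spatial x := by
  rw [map_add, map_smul, spatial_radialVec, smul_smul, add_smul, one_smul]

/-- Along the line `x + σ (T, c x⃗)` with `0 ≤ 1 + σ c` the radius is `(1 + σ c) r`. [folklore] -/
theorem radius_add_smul_radialVec (x : E4) (T c : ℝ) {σ : ℝ} (hσ : 0 ≤ 1 + σ * c) :
    Kerr.radius 0 (x + σ • E4.ofTimeSpace T (c • E4.spatial x)) = (1 + σ * c) * Kerr.radius 0 x := by
  rw [Kerr.radius_zero_left, Kerr.radius_zero_left, E4.spatialNorm, E4.spatialNorm,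
    spatial_add_smul_radialVec, norm_smul, Real.norm_of_nonneg hσ]

/-- **The Schwarzschild quadratic form on a radial vector.** At a point `w` of the ray through `x⃗`,
`w⃗ = μ x⃗` with `μ > 0`, `r(x) > 0`: `g_w((T, c x⃗), (T, c x⃗)) = −T² + d² + (2M/(μ r)) (T + d)²` with
`d = c r`. Dafermos–Rodnianski arXiv:0811.0354, §5.1. [cite: arXiv08110354, §5.1] -/
theorem bilin_radialVec {x w : E4} {μ : ℝ} (hμ : 0 < μ) (hw : E4.spatial w = μ • E4.spatial x)
    (hx : 0 < Kerr.radius 0 x) (T c : ℝ) :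
    Kerr.bilin M 0 w (E4.ofTimeSpace T (c • E4.spatial x)) (E4.ofTimeSpace T (c • E4.spatial x)) =
      -T ^ 2 + (c * Kerr.radius 0 x) ^ 2 +
        2 * M / (μ * Kerr.radius 0 x) * (T + c * Kerr.radius 0 x) ^ 2 := by
  rw [Kerr.radius_zero_left] at hx ⊢
  have hxn : E4.spatialNorm x ≠ 0 := hx.ne'
  have hwn : E4.spatialNorm w = μ * E4.spatialNorm x := by
    rw [E4.spatialNorm, E4.spatialNorm, hw, norm_smul, Real.norm_of_nonneg hμ.le]
  have hwn0 : E4.spatialNorm w ≠ 0 := by rw [hwn]; positivity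
  rw [Kerr.bilin_zero_spin_apply M hwn0, spatial_radialVec, hw, hwn, E4.ofTimeSpace_apply_zero]
  have h1 : ⟪c • E4.spatial x, c • E4.spatial x⟫_ℝ = c ^ 2 * E4.spatialNorm x ^ 2 := by
    rw [real_inner_smul_left, real_inner_smul_right, real_inner_self_eq_norm_sq, E4.spatialNorm]; ring
  have h2 : ⟪μ • E4.spatial x, c • E4.spatial x⟫_ℝ = μ * c * E4.spatialNorm x ^ 2 := by
    rw [real_inner_smul_left, real_inner_smul_right, real_inner_self_eq_norm_sq, E4.spatialNorm]; ring
  rw [h1, h2]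
  have hμ0 : μ ≠ 0 := hμ.ne'
  field_simp

/-- The radial vector `(T, c x⃗)` with `T ≠ 0` is nonzero. [folklore] -/
theorem radialVec_ne_zero (x : E4) {T : ℝ} (hT : T ≠ 0) (c : ℝ) :
    E4.ofTimeSpace T (c • E4.spatial x) ≠ 0 := fun h ↦ by
  have := congrArg (fun z : E4 ↦ z 0) h
  simp only [E4.ofTimeSpace_apply_zero, PiLp.zero_apply] at this
  exact hT this

/-- `g(V, (T, c x⃗)) = −T` for the time orientation `V = −g♯(dt*)`: radial vectors with `T > 0` point to
the future half. [cite: arXiv08110354, §5.1] -/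
theorem bilin_timeVector_radialVec {w : E4} (hw : 0 < Kerr.radius 0 w) (x : E4) (T c : ℝ) :
    Kerr.bilin M 0 w (Kerr.timeVector M 0 w) (E4.ofTimeSpace T (c • E4.spatial x)) = -T := by
  rw [Kerr.bilin_timeVector hw, E4.ofTimeSpace_apply_zero]

/-- **Monotonicity in the radius.** For `M ≥ 0` the radial quadratic form only decreases outward along the
ray: at `z⃗ = μ x⃗` with `μ ≥ 1`, `g_z(v, v) ≤ −T² + d² + (2M/r(x))(T + d)²`, `v = (T, c x⃗)`, `d = c r(x)`.
[cite: arXiv08110354, §5.1] -/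
theorem bilin_radialVec_le (hM : 0 ≤ M) {x z : E4} {μ : ℝ} (hμ : 1 ≤ μ) (hz : E4.spatial z = μ • E4.spatial x)
    (hx : 0 < Kerr.radius 0 x) (T c : ℝ) :
    Kerr.bilin M 0 z (E4.ofTimeSpace T (c • E4.spatial x)) (E4.ofTimeSpace T (c • E4.spatial x)) ≤
      -T ^ 2 + (c * Kerr.radius 0 x) ^ 2 + 2 * M / Kerr.radius 0 x * (T + c * Kerr.radius 0 x) ^ 2 := by
  rw [bilin_radialVec (M := M) (by linarith) hz hx T c]
  have hsq : 0 ≤ (T + c * Kerr.radius 0 x) ^ 2 := sq_nonneg _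
  have hfrac : 2 * M / (μ * Kerr.radius 0 x) ≤ 2 * M / Kerr.radius 0 x :=
    div_le_div_of_nonneg_left (by linarith) hx (by nlinarith)
  nlinarith

/-! ### Outgoing and ingoing radial timelike segments -/

section Patch

-- `Kerr.spacetime` takes the instance hypothesis `[Kerr.Facts]` (analyticity/connectedness facts of the
-- Kerr–Schild chart, all proved in the tree); it is kept as a hypothesis and instantiated by the assembly file.
variable [Kerr.Facts]

/-- **Radial timelike segments of the patch.** If `σ ↦ y + σ v`, `v = (T, c x⃗)`, `T > 0`, stays (with a
margin `ε`) in the patch and `g(v, v) < 0` along it, its endpoint lies in `I⁺(y)` (`line_mem_chronologicalFuture`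
for the identity chart; `g(V, v) = −T < 0` makes `v` future-directed). [cite: ONeill1983, Ch. 14, p. 402] -/
theorem radialSegment_mem_chronologicalFuture {y x : E4} (hy : y ∈ Kerr.region (0 : ℝ) r₁) {T c ε : ℝ}
    (hT : 0 < T) (hε : 0 < ε)
    (hmem : ∀ σ ∈ Icc (-ε) (1 + ε), y + σ • E4.ofTimeSpace T (c • E4.spatial x) ∈ Kerr.region (0 : ℝ) r₁)
    (hneg : ∀ z : Kerr.region (0 : ℝ) r₁,
      z.1 ∈ (fun σ : ℝ ↦ y + σ • E4.ofTimeSpace T (c • E4.spatial x)) '' Icc 0 1 →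
        Kerr.bilin M 0 z.1 (E4.ofTimeSpace T (c • E4.spatial x)) (E4.ofTimeSpace T (c • E4.spatial x)) < 0) :
    (⟨y + (1 : ℝ) • E4.ofTimeSpace T (c • E4.spatial x), hmem 1 ⟨by linarith, by linarith⟩⟩ :
        (Kerr.spacetime M 0 r₁ hM).carrier) ∈
      (Kerr.spacetime M 0 r₁ hM).metric.chronologicalFuture (Kerr.spacetime M 0 r₁ hM).timeOrientation
        {⟨y, hy⟩} :=
  line_mem_chronologicalFuture (𝓢 := Kerr.spacetime M 0 r₁ hM) (U := Kerr.region 0 r₁) (Φ := fun z ↦ z)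
    contMDiff_id _ y hy one_pos hε hmem
    (fun z hz ↦ (congrArg (fun w : E4 ↦ (Kerr.spacetime M 0 r₁ hM).timeOrientation.IsFutureDirected
        (x := z) w) (Schw.mfderiv_self_apply z _)).mpr
      ⟨⟨(hneg z hz).le, radialVec_ne_zero x hT.ne' c⟩, by
        change Kerr.bilin M 0 z.1 (Kerr.timeVector M 0 z.1) _ < 0
        rw [bilin_timeVector_radialVec (Kerr.radius_pos_of_mem_region z.2)]
        linarith⟩)
    (fun z hz ↦ (congrArg (fun w : E4 ↦ (Kerr.spacetime M 0 r₁ hM).metric.IsTimelike (x := z) w)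
      (Schw.mfderiv_self_apply z _)).mpr (hneg z hz))

/-- **Outgoing escape to the far region.** From every point `x` of the patch with `r(x) > 2M` and for
every `R'` there is a point `z` of the patch with `r(z) > R'` in the chronological future of `x`: the
radial segment `σ ↦ x + σ (T, λ x⃗)`, `σ ∈ [0, 1]`, `λ ≥ 0` large, is future timelike once
`T > d (r + 2M)/(r − 2M)` (`d = λ r`): by `bilin_radialVec_le` it suffices to check the starting point, where
`g(v, v) = −T² + d² + (2M/r)(T + d)² = −(1 − 2M/r)(T − d (r + 2M)/(r − 2M))(T + d)`.
O'Neill 1983, Ch. 14, p. 402; Dafermos–Rodnianski arXiv:0811.0354, §5.1. [cite: arXiv08110354, §5.1] -/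
theorem exists_far_mem_chronologicalFuture (x : (Kerr.spacetime M 0 r₁ hM).carrier)
    (hx : 2 * M < Kerr.radius 0 x.1) (R' : ℝ) :
    ∃ z : (Kerr.spacetime M 0 r₁ hM).carrier, R' < Kerr.radius 0 z.1 ∧
      z ∈ (Kerr.spacetime M 0 r₁ hM).metric.chronologicalFuture (Kerr.spacetime M 0 r₁ hM).timeOrientation
        {x} := by
  have hr0 : 0 < Kerr.radius 0 x.1 := Kerr.radius_pos_of_mem_region x.2
  have hr1 : max r₁ 0 < Kerr.radius 0 x.1 := x.2
  -- scale factor `lam ≥ 0` with `(1 + lam) r > R'`, `d = lam r`, and the time step `T`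
  set lam : ℝ := max (R' / Kerr.radius 0 x.1) 0 with hlam
  have hlam0 : 0 ≤ lam := le_max_right _ _
  set d : ℝ := lam * Kerr.radius 0 x.1 with hd
  have hd0 : 0 ≤ d := by positivity
  have hden : 0 < Kerr.radius 0 x.1 - 2 * M := by linarith
  set T : ℝ := d * (Kerr.radius 0 x.1 + 2 * M) / (Kerr.radius 0 x.1 - 2 * M) + 1 with hT
  have hT0 : 0 < T := by
    have : 0 ≤ d * (Kerr.radius 0 x.1 + 2 * M) / (Kerr.radius 0 x.1 - 2 * M) :=
      div_nonneg (by nlinarith) hden.le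
    linarith
  -- margin keeping the (slightly extended) segment inside the patch
  set ε : ℝ := (Kerr.radius 0 x.1 - max r₁ 0) / (2 * d + 1) with hε
  have hε0 : 0 < ε := div_pos (by linarith) (by positivity)
  have hεd : ε * d < Kerr.radius 0 x.1 - max r₁ 0 := by
    have h1 : ε * (2 * d + 1) = Kerr.radius 0 x.1 - max r₁ 0 := by
      rw [hε, div_mul_cancel₀ _ (by positivity : (2 * d + 1) ≠ 0)]
    nlinarith
  have hmem : ∀ σ ∈ Icc (-ε) (1 + ε),
      x.1 + σ • E4.ofTimeSpace T (lam • E4.spatial x.1) ∈ Kerr.region (0 : ℝ) r₁ := by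
    intro σ hσ
    have hlow : -(ε * d) ≤ σ * lam * Kerr.radius 0 x.1 := by
      rw [hd]
      have := mul_le_mul_of_nonneg_right (show -ε ≤ σ from hσ.1) hlam0
      nlinarith
    have hc : 0 ≤ 1 + σ * lam := by
      by_contra h
      push Not at h
      have : (1 + σ * lam) * Kerr.radius 0 x.1 < 0 := mul_neg_of_neg_of_pos h hr0
      nlinarith [le_max_right r₁ 0]
    show max r₁ 0 < Kerr.radius 0 _
    rw [radius_add_smul_radialVec x.1 T lam hc]
    nlinarith
  -- timelike along the segment: compare with the starting point
  have hneg : ∀ z : Kerr.region (0 : ℝ) r₁,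
      z.1 ∈ (fun σ : ℝ ↦ x.1 + σ • E4.ofTimeSpace T (lam • E4.spatial x.1)) '' Icc 0 1 →
        Kerr.bilin M 0 z.1 (E4.ofTimeSpace T (lam • E4.spatial x.1))
          (E4.ofTimeSpace T (lam • E4.spatial x.1)) < 0 := by
    rintro z ⟨σ, hσ, hz⟩
    simp only at hz
    have hsp : E4.spatial z.1 = (1 + σ * lam) • E4.spatial x.1 := by rw [← hz, spatial_add_smul_radialVec]
    refine (bilin_radialVec_le hM (by nlinarith [hσ.1]) hsp hr0 T lam).trans_lt ?_
    rw [← hd]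
    have key : -T ^ 2 + d ^ 2 + 2 * M / Kerr.radius 0 x.1 * (T + d) ^ 2 =
        -((Kerr.radius 0 x.1 - 2 * M) / Kerr.radius 0 x.1) * 1 * (T + d) := by
      rw [hT]
      field_simp
      ring
    rw [key]
    have h3 : 0 < (Kerr.radius 0 x.1 - 2 * M) / Kerr.radius 0 x.1 := div_pos hden hr0
    nlinarith
  refine ⟨_, ?_, radialSegment_mem_chronologicalFuture (hM := hM) x.2 hT0 hε0 hmem hneg⟩
  show R' < Kerr.radius 0 (x.1 + (1 : ℝ) • E4.ofTimeSpace T (lam • E4.spatial x.1))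
  rw [radius_add_smul_radialVec x.1 T lam (by linarith)]
  have : R' / Kerr.radius 0 x.1 ≤ lam := le_max_left _ _
  rw [div_le_iff₀ hr0] at this
  nlinarith

/-- **Ingoing access from the far region.** Every point `x` of the patch `{r > r₁}` (in the black hole,
on the horizon or outside) lies in the chronological future of a point `z` with `r(z) > R'`, for every
`R'`: the INGOING radial segment from `z = x − (T, −λ x⃗)` to `x`, `λ ≥ 1` large, is future timelike for
`T = d (2 + q)/(1 + q)`, `d = λ r(x)`, `q = 2M/r(x)` — by `bilin_radialVec_le` it suffices to check the
endpoint `x`, where `g(v, v) = −T² + d² + q (T − d)² = −(T − d)(T + d − q (T − d)) < 0`.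
O'Neill 1983, Ch. 14, p. 402; Dafermos–Rodnianski arXiv:0811.0354, §5.1. [cite: arXiv08110354, §5.1] -/
theorem exists_far_mem_chronologicalPast (x : (Kerr.spacetime M 0 r₁ hM).carrier) (R' : ℝ) :
    ∃ z : (Kerr.spacetime M 0 r₁ hM).carrier, R' < Kerr.radius 0 z.1 ∧
      x ∈ (Kerr.spacetime M 0 r₁ hM).metric.chronologicalFuture (Kerr.spacetime M 0 r₁ hM).timeOrientation
        {z} := by
  have hr0 : 0 < Kerr.radius 0 x.1 := Kerr.radius_pos_of_mem_region x.2
  have hr1 : max r₁ 0 < Kerr.radius 0 x.1 := x.2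
  -- scale factor `lam ≥ 1` with `(1 + lam) r > R'`, `d = lam r`, `q = 2M/r`, time step `T`
  set lam : ℝ := max (R' / Kerr.radius 0 x.1) 1 with hlam
  have hlam1 : 1 ≤ lam := le_max_right _ _
  set d : ℝ := lam * Kerr.radius 0 x.1 with hd
  have hd0 : 0 < d := by positivity
  set q : ℝ := 2 * M / Kerr.radius 0 x.1 with hq
  have hq0 : 0 ≤ q := by positivity
  set T : ℝ := d * (2 + q) / (1 + q) with hT
  have hTq : T * (1 + q) = d * (2 + q) := by rw [hT, div_mul_cancel₀ _ (by positivity : (1 + q) ≠ 0)]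
  have hTd : d < T := by nlinarith
  -- the starting point `y = x − v`, `v = (T, −lam x⃗)`; the segment is `y + σ v = x + (σ − 1) v`
  set y : E4 := x.1 - E4.ofTimeSpace T ((-lam) • E4.spatial x.1) with hy
  have hyv : ∀ σ : ℝ, y + σ • E4.ofTimeSpace T ((-lam) • E4.spatial x.1) =
      x.1 + (σ - 1) • E4.ofTimeSpace T ((-lam) • E4.spatial x.1) := fun σ ↦ by
    rw [hy, sub_smul, one_smul]; abel
  -- margin keeping the extended segment inside the patch
  set ε : ℝ := (Kerr.radius 0 x.1 - max r₁ 0) / (2 * d + 1) with hε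
  have hε0 : 0 < ε := div_pos (by linarith) (by positivity)
  have hεd : ε * d < Kerr.radius 0 x.1 - max r₁ 0 := by
    have h1 : ε * (2 * d + 1) = Kerr.radius 0 x.1 - max r₁ 0 := by
      rw [hε, div_mul_cancel₀ _ (by positivity : (2 * d + 1) ≠ 0)]
    nlinarith
  have hmem : ∀ σ ∈ Icc (-ε) (1 + ε),
      y + σ • E4.ofTimeSpace T ((-lam) • E4.spatial x.1) ∈ Kerr.region (0 : ℝ) r₁ := by
    intro σ hσ
    rw [hyv]
    have hup : (σ - 1) * lam * Kerr.radius 0 x.1 ≤ ε * d := by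
      rw [hd]
      have := mul_le_mul_of_nonneg_right (show σ - 1 ≤ ε by linarith [hσ.2]) (by linarith : (0 : ℝ) ≤ lam)
      nlinarith
    have hc : 0 ≤ 1 + (σ - 1) * -lam := by nlinarith [le_max_right r₁ 0]
    show max r₁ 0 < Kerr.radius 0 _
    rw [radius_add_smul_radialVec x.1 T (-lam) hc]
    nlinarith
  -- timelike along the segment: compare with the endpoint `x`
  have hneg : ∀ z : Kerr.region (0 : ℝ) r₁,
      z.1 ∈ (fun σ : ℝ ↦ y + σ • E4.ofTimeSpace T ((-lam) • E4.spatial x.1)) '' Icc 0 1 →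
        Kerr.bilin M 0 z.1 (E4.ofTimeSpace T ((-lam) • E4.spatial x.1))
          (E4.ofTimeSpace T ((-lam) • E4.spatial x.1)) < 0 := by
    rintro z ⟨σ, hσ, hz⟩
    simp only at hz
    have hsp : E4.spatial z.1 = (1 + (σ - 1) * -lam) • E4.spatial x.1 := by
      rw [← hz, hyv, spatial_add_smul_radialVec]
    refine (bilin_radialVec_le hM (by nlinarith [hσ.2]) hsp hr0 T (-lam)).trans_lt ?_
    have e1 : (-lam * Kerr.radius 0 x.1) ^ 2 = d ^ 2 := by rw [hd]; ring
    have e2 : T + -lam * Kerr.radius 0 x.1 = T - d := by rw [hd]; ring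
    rw [e1, e2, ← hq]
    have key : -T ^ 2 + d ^ 2 + q * (T - d) ^ 2 = -((T - d) * (T + d - q * (T - d))) := by ring
    rw [key, neg_lt_zero]
    exact mul_pos (by linarith) (by nlinarith)
  have hyreg : y ∈ Kerr.region (0 : ℝ) r₁ := by simpa using hmem 0 ⟨by linarith, by linarith⟩
  have key := radialSegment_mem_chronologicalFuture (hM := hM) hyreg (hd0.trans hTd) hε0 hmem hneg
  have hx' : (⟨y + (1 : ℝ) • E4.ofTimeSpace T ((-lam) • E4.spatial x.1), hmem 1 ⟨by linarith, by linarith⟩⟩ :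
      Kerr.region (0 : ℝ) r₁) = x :=
    Subtype.ext (show y + (1 : ℝ) • E4.ofTimeSpace T ((-lam) • E4.spatial x.1) = x.1 by
      rw [one_smul, hy]; exact sub_add_cancel _ _)
  rw [hx'] at key
  refine ⟨⟨y, hyreg⟩, ?_, key⟩
  show R' < Kerr.radius 0 y
  have e : y = x.1 + (-1 : ℝ) • E4.ofTimeSpace T ((-lam) • E4.spatial x.1) := by
    rw [hy, neg_one_smul, sub_eq_add_neg]
  rw [e, radius_add_smul_radialVec x.1 T (-lam) (by nlinarith)]
  have : R' / Kerr.radius 0 x.1 ≤ lam := le_max_left _ _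
  rw [div_le_iff₀ hr0] at this
  nlinarith

/-! ### `I⁺`, `I⁻`, the d.o.c. and the horizon of the far cylinder -/

omit [Kerr.Facts] in
/-- The far cylinder `{r > R}` lies in the patch `{r > r₁}` for `r₁ ≤ R`. [folklore] -/
theorem farCylinder_le {R : ℝ} (hR : r₁ ≤ R) : Kerr.region (0 : ℝ) R ≤ Kerr.region 0 r₁ :=
  Kerr.region_mono 0 hR

/-- Membership in the range of the inclusion of the far cylinder: `r > max R 0`. [folklore] -/
theorem mem_range_inclusion_iff {R : ℝ} (hR : r₁ ≤ R) {x : (Kerr.spacetime M 0 r₁ hM).carrier} :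
    x ∈ Set.range (Opens.inclusion (farCylinder_le hR) : Kerr.region (0 : ℝ) R → Kerr.region (0 : ℝ) r₁) ↔
      max R 0 < Kerr.radius 0 x.1 := by
  constructor
  · rintro ⟨y, rfl⟩
    exact y.2
  · intro hx
    exact ⟨⟨x.1, hx⟩, rfl⟩

/-- **`I⁺(cyl_R)` is the whole patch**: every event of `{r > r₁}` is reached by an ingoing radial timelike
segment from the far cylinder (`exists_far_mem_chronologicalPast`). O'Neill 1983, Ch. 14, p. 402.
[cite: ONeill1983, Ch. 14, p. 402] -/
theorem chronologicalFuture_farCylinder_eq_univ {R : ℝ} (hR : r₁ ≤ R) :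
    (Kerr.spacetime M 0 r₁ hM).metric.chronologicalFuture (Kerr.spacetime M 0 r₁ hM).timeOrientation
      (Set.range (Opens.inclusion (farCylinder_le hR) : Kerr.region (0 : ℝ) R → Kerr.region (0 : ℝ) r₁)) =
      univ := by
  refine eq_univ_of_forall fun x ↦ ?_
  obtain ⟨z, hz, hxz⟩ := exists_far_mem_chronologicalPast (hM := hM) x (max R 0)
  exact chronologicalFuture_mono (singleton_subset_iff.mpr ((mem_range_inclusion_iff hR).mpr hz)) hxz

/-- **`I⁻(cyl_R) = {r > 2M}`** for `R ≥ 2M > 0`, `0 < r₁ ≤ 2M`: the cylinder lies in the exterior, whose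
chronological past is the exterior (`SchwModelT2.chronologicalPast_subset_O`: no escape from the black
hole, O'Neill 1995, §2.5), and every exterior point escapes to the cylinder along an outgoing radial
timelike segment (`exists_far_mem_chronologicalFuture`). [cite: ONeill1995, §2.5] -/
theorem chronologicalPast_farCylinder_eq (hM' : 0 < M) (hr₁ : 0 < r₁) (hr₂ : r₁ ≤ 2 * M) {R : ℝ}
    (hR : r₁ ≤ R) (h2R : 2 * M ≤ R) :
    (Kerr.spacetime M 0 r₁ hM).metric.chronologicalPast (Kerr.spacetime M 0 r₁ hM).timeOrientation
      (Set.range (Opens.inclusion (farCylinder_le hR) : Kerr.region (0 : ℝ) R → Kerr.region (0 : ℝ) r₁)) =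
      {x | 2 * M < Kerr.radius 0 x.1} := by
  -- the parameters of the exact Schwarzschild model on this patch (`R₀ = 100 M` is not used here)
  let P : SchwModel.Params := ⟨M, r₁, 100 * M, hM', hr₁, hr₂, le_rfl⟩
  refine Subset.antisymm ?_ fun x hx ↦ ?_
  · have hsub : Set.range (Opens.inclusion (farCylinder_le hR) : Kerr.region (0 : ℝ) R → Kerr.region (0 : ℝ) r₁)
        ⊆ SchwModel.O P := by
      rintro _ ⟨y, rfl⟩
      show 2 * M < Kerr.radius 0 y.1
      exact lt_of_le_of_lt (h2R.trans (le_max_left R 0)) y.2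
    exact SchwModelT2.chronologicalPast_subset_O P hsub
  · obtain ⟨z, hz, hxz⟩ := exists_far_mem_chronologicalFuture (hM := hM) x hx (max R 0)
    rw [mem_chronologicalPast_iff_exists]
    exact ⟨z, (mem_range_inclusion_iff hR).mpr hz, hxz⟩

/-- **The domain of outer communications of the cylinder end is the Schwarzschild exterior**
`I⁺(cyl_R) ∩ I⁻(cyl_R) = {r > 2M}`. Wald 1984, §12.1. [cite: Wald1984, §12.1] -/
theorem docOfEnd_farCylinder_eq (hM' : 0 < M) (hr₁ : 0 < r₁) (hr₂ : r₁ ≤ 2 * M) {R : ℝ} (hR : r₁ ≤ R)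
    (h2R : 2 * M ≤ R) :
    (Kerr.spacetime M 0 r₁ hM).docOfEnd
      (Set.range (Opens.inclusion (farCylinder_le hR) : Kerr.region (0 : ℝ) R → Kerr.region (0 : ℝ) r₁)) =
      {x | 2 * M < Kerr.radius 0 x.1} := by
  change (Kerr.spacetime M 0 r₁ hM).metric.chronologicalFuture (Kerr.spacetime M 0 r₁ hM).timeOrientation
      (Set.range (Opens.inclusion (farCylinder_le hR) : Kerr.region (0 : ℝ) R → Kerr.region (0 : ℝ) r₁)) ∩
    (Kerr.spacetime M 0 r₁ hM).metric.chronologicalPast (Kerr.spacetime M 0 r₁ hM).timeOrientation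
      (Set.range (Opens.inclusion (farCylinder_le hR) : Kerr.region (0 : ℝ) R → Kerr.region (0 : ℝ) r₁)) = _
  rw [chronologicalFuture_farCylinder_eq_univ hR, chronologicalPast_farCylinder_eq hM' hr₁ hr₂ hR h2R,
    univ_inter]

/-- **The future event horizon of the cylinder end is the Schwarzschild horizon `{r = 2M}`**:
`∂I⁻(cyl_R) ∩ I⁺(cyl_R) = ∂{r > 2M} ∩ {r > r₁} = {r = 2M}` on a horizon-penetrating patch (`r₁ < 2M`:
`closure {r > 2M} = {r ≥ 2M}`, `SchwModelT2.closure_O_eq`). Wald 1984, §12.1; Hawking–Ellis 1973, §9.2.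
[cite: Wald1984, §12.1] -/
theorem futureEventHorizonOfEnd_farCylinder_eq (hM' : 0 < M) (hr₁ : 0 < r₁) (hr₂ : r₁ ≤ 2 * M) {R : ℝ}
    (hR : r₁ ≤ R) (h2R : 2 * M ≤ R) :
    (Kerr.spacetime M 0 r₁ hM).futureEventHorizonOfEnd
      (Set.range (Opens.inclusion (farCylinder_le hR) : Kerr.region (0 : ℝ) R → Kerr.region (0 : ℝ) r₁)) =
      {x | Kerr.radius 0 x.1 = 2 * M} := by
  let P : SchwModel.Params := ⟨M, r₁, 100 * M, hM', hr₁, hr₂, le_rfl⟩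
  change frontier ((Kerr.spacetime M 0 r₁ hM).metric.chronologicalPast (Kerr.spacetime M 0 r₁ hM).timeOrientation
      (Set.range (Opens.inclusion (farCylinder_le hR) : Kerr.region (0 : ℝ) R → Kerr.region (0 : ℝ) r₁))) ∩
    (Kerr.spacetime M 0 r₁ hM).metric.chronologicalFuture (Kerr.spacetime M 0 r₁ hM).timeOrientation
      (Set.range (Opens.inclusion (farCylinder_le hR) : Kerr.region (0 : ℝ) R → Kerr.region (0 : ℝ) r₁)) = _
  rw [chronologicalFuture_farCylinder_eq_univ hR, chronologicalPast_farCylinder_eq hM' hr₁ hr₂ hR h2R,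
    inter_univ]
  have hcl : closure {x : (Kerr.spacetime M 0 r₁ hM).carrier | 2 * M < Kerr.radius 0 x.1} =
      {x | 2 * M ≤ Kerr.radius 0 x.1} := SchwModelT2.closure_O_eq P
  have hop : IsOpen {x : (Kerr.spacetime M 0 r₁ hM).carrier | 2 * M < Kerr.radius 0 x.1} :=
    SchwModelT2.isOpen_O P
  rw [frontier, hop.interior_eq, hcl]
  ext x
  simp only [Set.mem_sdiff, mem_setOf_eq, not_lt]
  constructor
  · rintro ⟨h1, h2⟩
    exact le_antisymm h2 h1
  · intro h
    exact ⟨h.ge, h.le⟩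

end Patch

/-- Registered summary (stmt-FinalStateConjecture-17430, route seat 1): **causal anatomy of the far cylinder of
the horizon-penetrating Schwarzschild patch** — `I⁺(cyl_R) = {r > r₁}`, `I⁻(cyl_R) = {r > 2M}`, d.o.c.
`= {r > 2M}`, future event horizon `= {r = 2M}` (`0 < r₁ ≤ 2M ≤ R`). [cite: Wald1984, §12.1] -/
theorem schwarzschild_farCylinder_anatomy : ∀ [Kerr.Facts] {M r₁ : ℝ} (hM : 0 < M), 0 < r₁ → r₁ ≤ 2 * M → ∀ {R : ℝ} (hR : r₁ ≤ R), 2 * M ≤ R → (Kerr.spacetime M 0 r₁ hM.le).metric.chronologicalFuture (Kerr.spacetime M 0 r₁ hM.le).timeOrientation (Set.range (Opens.inclusion (Kerr.region_mono 0 hR) : Kerr.region (0 : ℝ) R → Kerr.region (0 : ℝ) r₁)) = Set.univ ∧ (Kerr.spacetime M 0 r₁ hM.le).metric.chronologicalPast (Kerr.spacetime M 0 r₁ hM.le).timeOrientation (Set.range (Opens.inclusion (Kerr.region_mono 0 hR) : Kerr.region (0 : ℝ) R → Kerr.region (0 : ℝ) r₁)) = {x | 2 * M < Kerr.radius 0 x.1}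 ∧ (Kerr.spacetime M 0 r₁ hM.le).docOfEnd (Set.range (Opens.inclusion (Kerr.region_mono 0 hR) : Kerr.region (0 : ℝ) R → Kerr.region (0 : ℝ) r₁)) = {x | 2 * M < Kerr.radius 0 x.1} ∧ (Kerr.spacetime M 0 r₁ hM.le).futureEventHorizonOfEnd (Set.range (Opens.inclusion (Kerr.region_mono 0 hR) : Kerr.region (0 : ℝ) R → Kerr.region (0 : ℝ) r₁)) = {x | Kerr.radius 0 x.1 = 2 * M} :=
  fun hM hr₁ hr₂ _ hR h2R ↦ ⟨chronologicalFuture_farCylinder_eq_univ hR,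
    chronologicalPast_farCylinder_eq hM hr₁ hr₂ hR h2R, docOfEnd_farCylinder_eq hM hr₁ hr₂ hR h2R,
    futureEventHorizonOfEnd_farCylinder_eq hM hr₁ hr₂ hR h2R⟩

end Summit.FinalStateConjecture.FinalStateConjecture.Theorems.TameHull.Schw

end
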